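import Summits.AtomisticToContinuum.FouriersLaw.Theorems.BondHeatUncertaintyBoundedResponseBathHeatOwedHeat
import HarnessLib

/-!
# BondHeatUncertainty / BoundedResponse — «OwedHeatPrice» §0–§2: the GRADED ROUTE STATEMENTS of the diffusive price table — (DC_{a,α})
`LateReturnCeiling`, (DF_{a,α}) `LateReturnFloor`, (T1_{a,g}) `LateVariationBudget`, (T2⁸_a) `OctaveSquareBudget`, (LC_{a,η}) `LightConeIncompleteness`,
(LRF_{a,η}) `LightConeReturnFloor` — and the block tools (Cauchy–Schwarz on one block of lags, ★ dyadic summation of octave square budgets)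
(decomp-a2c lens-1 «grading / quantitative ladder», g116, NODE 116 «OwedHeatPrice»; part 1 of 3; chain A → B → main; the prices, doors, refutations, the
light-cone door and the OVERVIEW with the census pre-registration are in parts B / main; this file imports only the tree: NODE 115 `…BathHeatOwedHeat` + `HarnessLib`)

Each `def … : Prop` below is a ROUTE STATEMENT of this cell — conjectural, docstring-tagged, eventually in `N`, late lags `v ≥ aN` only — NOT a literature fact,
NOT 11071 or (S) reworded (MustFail116 in the cell's CHECKS-g116.md).  (DC)/(DF) are the PRICING HYPOTHESES (the two-sided diffusive return law
`(γ/T²)𝒯_N(v) ≍ A·v^{−1/2}`), (T1)/(T2⁸) the sign-free suppliers they price, (LC)/(LRF) the light-cone pieces.  §0: `C·N^p < κ·N^q` eventually (`p < q`,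
`κ > 0`); `log(c₀N/a) ≥ M` eventually.  §2: `(∫_s^t|𝒯_N|)² ≤ (t−s)∫_s^t𝒯_N²`; ★ `dyadic_variation_le`: octave budgets `γ⁴∫_w^{2w}𝒯² ≤ C` on `[v₀, W]` give
`γ²∫_v^{2^k v}|𝒯_N| ≤ √C(√2+1)√(2^k v)`.  No `sorry`, no new axioms.
-/

noncomputable section

open MeasureTheory ProbabilityTheory Filter Topology Set Function
open scoped NNReal ENNReal
open Literature.MathematicalPhysics.KineticTheory.HeatConduction
open Literature.MathematicalPhysics.KineticTheory OscillatorChain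
open Literature.Probability.Process
open Summit.AtomisticToContinuum.FouriersLaw.Theorems.SubdiffusiveBondHeat
open Summit.AtomisticToContinuum.FouriersLaw.Theorems.SubdiffusiveBondHeat.EscapeGrading
open Summit.AtomisticToContinuum.FouriersLaw.Theorems.BoundedResponse.TransientBand

namespace Summit.AtomisticToContinuum.FouriersLaw.Theorems.BoundedResponse.HeatSpreading

open Summit.AtomisticToContinuum.FouriersLaw.Theses.BondHeatUncertainty (BoundedResponse SubdiffusiveBondHeat)

/-! ## §0 Two real-variable growth lemmas -/

section Generic

/-- A larger power of `N` eventually beats a smaller one with any constants: `p < q`, `κ > 0` ⟹ `C·N^p < κ·N^q` for all large `N`.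
[formal bookkeeping] -/
theorem exists_nat_rpow_dominate {p q κ : ℝ} (hpq : p < q) (hκ : 0 < κ) (C : ℝ) :
    ∃ N₁ : ℕ, ∀ N : ℕ, N₁ ≤ N → C * (N : ℝ) ^ p < κ * (N : ℝ) ^ q := by
  have ht : Tendsto (fun x : ℝ => x ^ (q - p)) atTop atTop := tendsto_rpow_atTop (by linarith)
  obtain ⟨x₀, hx₀⟩ := Filter.eventually_atTop.1 (ht.eventually_gt_atTop (C / κ))
  refine ⟨max 1 (Nat.ceil x₀), fun N hN => ?_⟩
  have hN1 : (1:ℝ) ≤ N := by exact_mod_cast le_trans (le_max_left _ _) hN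
  have hNx : x₀ ≤ (N:ℝ) := le_trans (Nat.le_ceil _) (by exact_mod_cast le_trans (le_max_right _ _) hN)
  have hNpos : (0:ℝ) < N := by linarith
  have h1 : C / κ < (N:ℝ) ^ (q - p) := hx₀ N hNx
  have h2 : C < κ * (N:ℝ) ^ (q - p) := by
    rw [div_lt_iff₀ hκ] at h1; linarith [mul_comm ((N:ℝ) ^ (q - p)) κ]
  have hp0 : 0 < (N:ℝ) ^ p := Real.rpow_pos_of_pos hNpos p
  calc C * (N:ℝ) ^ p < κ * (N:ℝ) ^ (q - p) * (N:ℝ) ^ p := mul_lt_mul_of_pos_right h2 hp0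
    _ = κ * (N:ℝ) ^ q := by rw [mul_assoc, ← Real.rpow_add hNpos, sub_add_cancel]

/-- The logarithm of the late window's aspect ratio `c₀N²/(aN) = c₀N/a` is eventually as large as we please. [formal bookkeeping] -/
theorem exists_nat_log_window_ge {a c₀ : ℝ} (ha : 0 < a) (hc₀ : 0 < c₀) (M : ℝ) :
    ∃ N₁ : ℕ, ∀ N : ℕ, N₁ ≤ N → M ≤ Real.log (c₀ * (N : ℝ) / a) := by
  refine ⟨Nat.ceil (a * Real.exp M / c₀), fun N hN => ?_⟩
  have hN : a * Real.exp M / c₀ ≤ (N : ℝ) := le_trans (Nat.le_ceil _) (by exact_mod_cast hN)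
  have hpos : 0 < c₀ * (N : ℝ) / a := by
    have : 0 < a * Real.exp M / c₀ := by positivity
    have hN0 : (0:ℝ) < N := this.trans_le hN
    positivity
  rw [Real.le_log_iff_exp_le hpos, le_div_iff₀ ha]
  rw [div_le_iff₀ hc₀] at hN
  linarith

end Generic

section Chain

variable {ω₂ lam β γ : ℝ} {T : ℝ}

/-! ## §1 The graded hypotheses: diffusive CEILING and FLOOR of the late owed heat, the late VARIATION budget, the OCTAVE square
budget, and the two light-cone pieces -/

/-- **(DC_{a,α}) `LateReturnCeiling a α`** — TWO-SIDED POWER-LAW CEILING of the late owed heat: `∀ c > 0 ∃ A N₀ ∀ N ≥ N₀ ∀ v ∈ [aN, cN²]: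
|𝒯_N(v)| ≤ A·v^{−α}`.  At `α = 1/2` this is the DIFFUSIVE RETURN LAW from above (semi-infinite-chain heuristic and desk readout OWED-115:
`(γ/T²)𝒯_N(v) ≈ 0.37·v^{−1/2}`, `N = 32…128`, `N`-free).  PRICING HYPOTHESIS of this node (every sign-free supplier below is derived from it at
the grade it forces); not itself a proof target.  Tags: UNDECIDED · `N`-FREE-in-spirit (boundary return law of the half-infinite chain) · INSTRUMENTABLE
(OWED-115 tables) · IDEA-NEEDED (a quantitative decay rate of a boundary autocorrelation of an infinite anharmonic system) · for `α > 1/2` FALSE-leaning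
(`not_lateReturnCeiling_of_lateReturnFloor`). [route statement · this cell; NOT a literature fact] [new] -/
def LateReturnCeiling (a α : ℝ) : Prop :=
  ∀ ω₂ lam β γ : ℝ, 0 < ω₂ → 0 < lam → 0 < β → 0 < γ → ∀ T : ℝ, 0 < T → ∀ c : ℝ, 0 < c →
    ∃ A : ℝ, ∃ N₀ : ℕ, ∀ N : ℕ, N₀ ≤ N → ∀ v : ℝ, a * N ≤ v → v ≤ c * (N : ℝ) ^ 2 →
      |owedHeat ω₂ lam β γ T N v| ≤ A * v ^ (-α)

/-- **(DF_{a,α}) `LateReturnFloor a α`** — POSITIVE POWER-LAW FLOOR of the late owed heat on an initial Thouless fraction: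
`∃ c₀ > 0 ∃ a₀ > 0 ∃ N₀ ∀ N ≥ N₀ ∀ v ∈ [aN, c₀N²]: 𝒯_N(v) ≥ a₀·v^{−α}`.  At `α = 1/2` the diffusive return law FROM BELOW (the chain still owes
the contact at least the diffusive amount of heat).  The NEGATIVE-PRICING HYPOTHESIS: everything it refutes is «diffusive-FALSE».  STRONGER than
(OH_a) on its window (a sign with a rate).  Tags: UNDECIDED · `N`-FREE-in-spirit · INSTRUMENTABLE (OWED-115: `N^{1/2}(γ/T²)𝒯_N(aN)` flat ≈ 0.8 at
`a = 1/4`) · IDEA-NEEDED · used here ONLY as the calibrating adversary of the price table. [route statement · this cell; NOT a literature fact] [new] -/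
def LateReturnFloor (a α : ℝ) : Prop :=
  ∀ ω₂ lam β γ : ℝ, 0 < ω₂ → 0 < lam → 0 < β → 0 < γ → ∀ T : ℝ, 0 < T →
    ∃ c₀ : ℝ, 0 < c₀ ∧ ∃ a₀ : ℝ, 0 < a₀ ∧ ∃ N₀ : ℕ, ∀ N : ℕ, N₀ ≤ N → ∀ v : ℝ, a * N ≤ v → v ≤ c₀ * (N : ℝ) ^ 2 →
      a₀ * v ^ (-α) ≤ owedHeat ω₂ lam β γ T N v

/-- **(T1_{a,g}) `LateVariationBudget a g`** — the LATE TOTAL-VARIATION BUDGET of the contact step response: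
`∀ c > 0 ∃ C N₀ ∀ N ≥ N₀: γ²∫_{aN}^{cN²} |𝒯_N(v)| dv ≤ C·N^g` (in response units `γT²∫|θ_N(∞) − θ_N(v)|dv`).  SIGN-FREE; `(T1_{a,g}) ⟹ (OB_{a,g})`
(`lateOvershootBudget_of_lateVariationBudget`), so `g = 1` supplies the residual of record beneath (S).  DIFFUSIVE PRICE: TRUE at `g = 1` with NO
exponent to spare (`(DC_{a,1/2}) ⟹ (T1_{a,1})`, constant `2γT²A√c`; `(DF_{a,1/2}) ⟹ ¬(T1_{a,g})` for every `g < 1`) — exponent-CRITICAL on the true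
side.  Tags: UNDECIDED · SIGN-FREE · INSTRUMENTABLE (OWED-115: `γ²N⁻¹Σ_v N|R_N(v)|Δv` should be `N`-flat ≈ `2γT²A√c`) · IDEA-NEEDED (= the diffusive
return rate in `L¹`-mean). [route statement · this cell; NOT a literature fact] [new] -/
def LateVariationBudget (a g : ℝ) : Prop :=
  ∀ ω₂ lam β γ : ℝ, 0 < ω₂ → 0 < lam → 0 < β → 0 < γ → ∀ T : ℝ, 0 < T → ∀ c : ℝ, 0 < c →
    ∃ C : ℝ, ∃ N₀ : ℕ, ∀ N : ℕ, N₀ ≤ N →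
      γ ^ 2 * ∫ v in (a * N)..(c * (N : ℝ) ^ 2), |owedHeat ω₂ lam β γ T N v| ≤ C * (N : ℝ) ^ g

/-- **(T2⁸_a) `OctaveSquareBudget a`** — the OCTAVE (scale-invariant) SQUARE BUDGET of the late owed heat: `∀ c > 0 ∃ C N₀ ∀ N ≥ N₀
∀ [v,2v] ⊂ [aN, cN²]: γ⁴∫_v^{2v} 𝒯_N(u)² du ≤ C` — every late OCTAVE of lags carries `O(1)` mean-square owed heat.  ★ THE SIGN-FREE `L²` SUPPLIER
THAT SURVIVES THE DIFFUSIVE LAW: `(DC_{a,1/2}) ⟹ (T2⁸_a)` with `C = γ⁴A²` (`∫_v^{2v}u^{−1}du ≤ 1`), whereas NODE 115's window budget `(T2_{a,0})`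
is diffusive-FALSE (`γ⁴∫_{aN}^{cN²}𝒯² ≥ γ⁴a₀²·log(c₀N/a) → ∞`, `not_lateOwedHeatSquareBudget_zero_of_lateReturnFloor`): the window integral of the
scale-invariant density `𝒯² ≍ v^{−1}` is a LOGARITHM, the octave integral is a CONSTANT.  Door: `(T2⁸_a) ⟹ (T1_{a,1}) ⟹ (OB_{a,1})` by blockwise
Cauchy–Schwarz and a dyadic (geometric `Σ2^{j/2}`) sum (`lateVariationBudget_one_of_octaveSquareBudget`).  Spectral face (pointer): a dyadic
(Besov `B^{1/2}_{2,∞}`-type) form of the critic's low-frequency Hölder-½ reading of `K̂_N` (row 1570), in place of the plain `H^{−1}` form which the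
log kills.  Tags: UNDECIDED · SIGN-FREE · exponent-CRITICAL (true side) · INSTRUMENTABLE (OWED-115: max over dyadic `v ∈ [aN, cN²/2]` of
`γ²T⁴Σ_{[v,2v]}((1−E_N) − S_N)²Δv`, predicted `N`-flat ≈ `γ²T⁴A²log 2`) · IDEA-NEEDED. [route statement · this cell; NOT a literature fact] [new] -/
def OctaveSquareBudget (a : ℝ) : Prop :=
  ∀ ω₂ lam β γ : ℝ, 0 < ω₂ → 0 < lam → 0 < β → 0 < γ → ∀ T : ℝ, 0 < T → ∀ c : ℝ, 0 < c →
    ∃ C : ℝ, ∃ N₀ : ℕ, ∀ N : ℕ, N₀ ≤ N → ∀ v : ℝ, a * N ≤ v → 2 * v ≤ c * (N : ℝ) ^ 2 →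
      γ ^ 4 * ∫ u in v..(2 * v), owedHeat ω₂ lam β γ T N u ^ 2 ≤ C

/-- **(LC_{a,η}) `LightConeIncompleteness a η`** — `∃ A N₀ ∀ N ≥ N₀: 1 − θ_N(aN) ≤ A/N^η`: at the LIGHT-CONE lag `aN` the contact step response
has completed all but `O(N^{−η})` of its rise (`1 − θ_N(aN) = E_N + (γ/T²)𝒯_N(aN) = X_N + S_N`: transmission not yet arrived + heat still stored).
With the one-lag return floor it gives the EXPONENT RUNG `ExponentFloor η` (`exponentFloor_of_lightCone`); its DIFFUSIVE CEILING is EXACTLY `η = 1/2`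
(`(DF_{a,α}) ⟹ ¬(LC_{a,η})` for `η > α`, `not_lightConeIncompleteness_of_lateReturnFloor`) — the typed form of the g55 remark «the light-cone split
lands at `N^{−1/2}` and no more» (`…EscapeGrading`, `HalfOhmicFloor`).  Why interesting at `η = 1/2`: it is `N`-FREE in spirit — the semi-infinite
chain's survival law `S_∞(t) ≤ A·t^{−1/2}` plus light-cone locality `|θ_N(aN) − θ_∞(aN)| ≪ N^{−1/2}` (`a` below the sound speed) would give it.
Desk readout (OWED-115 tables, `a = 1/4`): `√N·(1 − θ_N(N/4)) = 0.69, 0.84, 0.84, 0.79` (`N = 16, 32, 64, 128`) — flat, as `η = 1/2` exactly predicts.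
Tags: UNDECIDED · for `η ≤ 1/2` TRUE-leaning & `N`-FREE-in-spirit, for `η > 1/2` diffusive-FALSE · INSTRUMENTABLE · IDEA-NEEDED (semi-infinite
return law + locality). [route statement · this cell; NOT a literature fact] [new] -/
def LightConeIncompleteness (a η : ℝ) : Prop :=
  ∀ ω₂ lam β γ : ℝ, 0 < ω₂ → 0 < lam → 0 < β → 0 < γ → ∀ T : ℝ, 0 < T →
    ∃ A : ℝ, ∃ N₀ : ℕ, ∀ N : ℕ, N₀ ≤ N → 1 - stepResponse ω₂ lam β γ T N (a * N) ≤ A / (N : ℝ) ^ η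

/-- **(LRF_{a,η}) `LightConeReturnFloor a η`** — ONE-LAG graded floor of the return tail at the light-cone lag: `∃ A N₀ ∀ N ≥ N₀:
(γ/T²)𝒯_N(aN) ≥ −A/N^η`.  Implied by (OH_a) with `A = 0`; at `η = 1/2` implied by the tree's amplitude-free kernel floor `BathKernelFloor 0 (3/2)` in
spirit (integrate `K_N ≥ −A r^{−3/2}` beyond `aN`).  The second piece of the light-cone door.  Tags: UNDECIDED · TRUE-leaning · phonon-TRUE ·
INSTRUMENTABLE. [route statement · this cell; NOT a literature fact] [new] -/
def LightConeReturnFloor (a η : ℝ) : Prop :=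
  ∀ ω₂ lam β γ : ℝ, 0 < ω₂ → 0 < lam → 0 < β → 0 < γ → ∀ T : ℝ, 0 < T →
    ∃ A : ℝ, ∃ N₀ : ℕ, ∀ N : ℕ, N₀ ≤ N → -(A / (N : ℝ) ^ η) ≤ γ / T ^ 2 * owedHeat ω₂ lam β γ T N (a * N)

section Pos

variable (hω : 0 < ω₂) (hl : 0 < lam) (hβ : 0 < β) (hγ : 0 < γ) (hT : 0 < T)
include hω hl hβ hγ hT

/-! ## §2 Block tools: Cauchy–Schwarz on one block of lags and the dyadic summation -/

/-- Cauchy–Schwarz on one block: `(∫_s^t |𝒯_N|)² ≤ (t − s)·∫_s^t 𝒯_N²` (`0 ≤ s ≤ t`). [formal bookkeeping] -/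
theorem sq_integral_abs_owedHeat_le (N : ℕ) {s t : ℝ} (hs : 0 ≤ s) (hst : s ≤ t) :
    (∫ v in s..t, |owedHeat ω₂ lam β γ T N v|) ^ 2 ≤ (t - s) * ∫ v in s..t, owedHeat ω₂ lam β γ T N v ^ 2 := by
  have hI := (intervalIntegrable_owedHeat hω hl hβ hγ hT N hs hst).1
  have hc : ContinuousOn (owedHeat ω₂ lam β γ T N) (uIcc s t) := by
    rw [uIcc_of_le hst]
    exact (continuousOn_owedHeat hω hl hβ hγ hT N (hs.trans hst)).mono (Icc_subset_Icc_left hs)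
  have h2 : IntervalIntegrable (fun v => |owedHeat ω₂ lam β γ T N v| ^ 2) volume s t := by
    simp_rw [sq_abs]; exact (hc.pow 2).intervalIntegrable
  have h1 := Literature.Analysis.FunctionSpaces.sq_intervalIntegral_le hst hI.abs h2
  simp_rw [sq_abs] at h1
  exact h1

/-- **Dyadic summation.** If every block `[w, 2w]` with `v₀ ≤ w`, `2w ≤ W` carries `γ⁴∫_w^{2w}𝒯_N² ≤ C` (`v₀ > 0`, `C ≥ 0`), then for every `k` and every
`v ≥ v₀` with `2^k v ≤ W`: `γ²∫_v^{2^k v}|𝒯_N| ≤ √C·(√2 + 1)·√(2^k v)` (blockwise Cauchy–Schwarz, geometric sum `Σ_{j<k} 2^{j/2} ≤ (√2+1)2^{k/2}`,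
run as an induction on `k` splitting off the TOP block). [formal bookkeeping] -/
theorem dyadic_variation_le (N : ℕ) {v₀ W C : ℝ} (hv₀ : 0 < v₀) (hC : 0 ≤ C)
    (hoct : ∀ w : ℝ, v₀ ≤ w → 2 * w ≤ W → γ ^ 4 * ∫ u in w..(2 * w), owedHeat ω₂ lam β γ T N u ^ 2 ≤ C) :
    ∀ (k : ℕ) (v : ℝ), v₀ ≤ v → (2:ℝ) ^ k * v ≤ W →
      γ ^ 2 * ∫ u in v..((2:ℝ) ^ k * v), |owedHeat ω₂ lam β γ T N u| ≤
        Real.sqrt C * (Real.sqrt 2 + 1) * Real.sqrt ((2:ℝ) ^ k * v) := by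
  intro k
  induction k with
  | zero =>
    intro v _ _
    simp only [pow_zero, one_mul, intervalIntegral.integral_same, mul_zero]
    positivity
  | succ k ih =>
    intro v hv hW
    have hv0 : 0 < v := hv₀.trans_le hv
    rw [show (2:ℝ) ^ (k + 1) * v = 2 * ((2:ℝ) ^ k * v) by ring] at hW ⊢
    have hA := ih v hv (by nlinarith [show (0:ℝ) < (2:ℝ) ^ k * v by positivity])
    have hvw : v ≤ (2:ℝ) ^ k * v := by
      have : (1:ℝ) ≤ (2:ℝ) ^ k := one_le_pow₀ (by norm_num)
      nlinarith
    have hw0 : 0 < (2:ℝ) ^ k * v := by positivity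
    generalize hwdef : (2:ℝ) ^ k * v = w at hA hW hvw hw0 ⊢
    have hI1 := (intervalIntegrable_owedHeat hω hl hβ hγ hT N hv0.le hvw).1.abs
    have hI2 := (intervalIntegrable_owedHeat hω hl hβ hγ hT N hw0.le (by linarith : w ≤ 2 * w)).1.abs
    rw [← intervalIntegral.integral_add_adjacent_intervals hI1 hI2, mul_add]
    -- the top block by Cauchy–Schwarz and the octave budget at `w`
    have hB0 := sq_integral_abs_owedHeat_le hω hl hβ hγ hT N hw0.le (by linarith : w ≤ 2 * w)
    have hoctw := hoct w (hv.trans hvw) hW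
    have hI0 : 0 ≤ ∫ u in w..(2 * w), |owedHeat ω₂ lam β γ T N u| :=
      intervalIntegral.integral_nonneg (by linarith) fun u _ => abs_nonneg _
    have hJ0 : 0 ≤ ∫ u in w..(2 * w), owedHeat ω₂ lam β γ T N u ^ 2 :=
      intervalIntegral.integral_nonneg (by linarith) fun u _ => sq_nonneg _
    have hB1 : (γ ^ 2 * ∫ u in w..(2 * w), |owedHeat ω₂ lam β γ T N u|) ^ 2 ≤ C * w := by
      rw [show (2:ℝ) * w - w = w by ring] at hB0
      have h4 : γ ^ 4 * ((∫ u in w..(2 * w), |owedHeat ω₂ lam β γ T N u|) ^ 2) ≤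
          γ ^ 4 * (w * ∫ u in w..(2 * w), owedHeat ω₂ lam β γ T N u ^ 2) := mul_le_mul_of_nonneg_left hB0 (by positivity)
      have h5 : w * (γ ^ 4 * ∫ u in w..(2 * w), owedHeat ω₂ lam β γ T N u ^ 2) ≤ w * C :=
        mul_le_mul_of_nonneg_left hoctw hw0.le
      nlinarith [h4, h5]
    have hB2 : γ ^ 2 * ∫ u in w..(2 * w), |owedHeat ω₂ lam β γ T N u| ≤ Real.sqrt C * Real.sqrt w := by
      rw [← Real.sqrt_mul hC, ← Real.sqrt_sq (mul_nonneg (by positivity) hI0 :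
        (0:ℝ) ≤ γ ^ 2 * ∫ u in w..(2 * w), |owedHeat ω₂ lam β γ T N u|)]
      exact Real.sqrt_le_sqrt hB1
    have hsq2w : Real.sqrt (2 * w) = Real.sqrt 2 * Real.sqrt w := Real.sqrt_mul (by norm_num) w
    have hs2 : Real.sqrt 2 * Real.sqrt 2 = 2 := Real.mul_self_sqrt (by norm_num)
    have key : Real.sqrt C * (Real.sqrt 2 + 1) * (Real.sqrt 2 * Real.sqrt w) =
        Real.sqrt C * (Real.sqrt 2 + 1) * Real.sqrt w + Real.sqrt C * Real.sqrt w := by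
      linear_combination (Real.sqrt C * Real.sqrt w) * hs2
    rw [hsq2w, key]
    exact add_le_add hA hB2

end Pos

end Chain

end Summit.AtomisticToContinuum.FouriersLaw.Theorems.BoundedResponse.HeatSpreading

end
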